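import Mathlib
import Summits.MatrixMultiplication.MatrixMultiplication.Theorems.SnSubsetDichotomyPolynomialSlackHeavyQuotients
import Summits.MatrixMultiplication.MatrixMultiplication.Theorems.SnSubsetDichotomyPolynomialSlackCylinderMarginals
import Summits.MatrixMultiplication.MatrixMultiplication.Theorems.SnSubsetDichotomyPolynomialSlackSpreadLevelOne
import Summits.MatrixMultiplication.MatrixMultiplication.Theorems.SnSubsetDichotomyPolynomialSlackEnergyFloor

/-!
# Collision floor: every member of a near-extremal TPP triple is level-one biased

Crux `Summit.MatrixMultiplication.MatrixMultiplication.Theses.SnSubsetDichotomy.PolynomialSlack`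
(item `stmt-MatrixMultiplication-8306`), level-one programme, lead c5 (wave 3). For a parity-pure TPP
triple `S, T, U ⊆ S_n` (`n ≥ 40`) with `N = |S||T||U|` the pinning `levelOnePinning` says
`2N − n! − n!√(n!)/√D ≤ 2(n−1)·N·(−τ)`, `τ` the centred level-one triple sum of the normalised pair
marginals, `D = n(n−1)/6`; the pair marginals factor through the set profiles (`pairMarginal_eq_sum_mul`),
and the energy floor `neg_centeredTripleSum_le_energy` bounds `−τ ≤ ‖Δ_U‖²/8`. Hence

* `collisionFloor` — `2N − n! − n!√(n!)/√D ≤ ((n−1)/4)·N·Σ_{v,q} (c_U(q→v)/|U| − 1/n)²`.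

So a triple beating the wall (`2N − n! − n!√(n!)/√D ≥ N`) has `Σ_{v,q}(c_U(q→v)/|U| − 1/n)² ≥ 4/(n−1)`
for EVERY member (rotate the triple): two random members of `U` agree in at least `1 + 4/(n−1)` positions
on average — no member of a near-extremal TPP triple is level-one flat. This is the first constraint of
the programme on individual members (rather than pair quotients) with an absolute constant.
-/

namespace Summit.MatrixMultiplication.MatrixMultiplication.Theorems.PolynomialSlack

open scoped BigOperators
open Literature.Combinatorics.Additive (TripleProductProperty)

set_option linter.dupNamespace false

set_option maxHeartbeats 1600000 in
/-- **Collision floor.** For `n ≥ 40` and a parity-pure TPP triple `S, T, U ⊆ S_n` with `N = |S||T||U|`: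
`2N − n! − n!√(n!)/√(n(n−1)/6) ≤ ((n−1)/4)·N·Σ_{v,q} (c_U(q→v)/|U| − 1/n)²` — every member of a TPP triple beating
the wall is level-one biased: its profile has energy `‖Δ_U‖² ≥ 8/(n−1)·(1 − o(1))`, i.e. two random members agree
in `≥ 1 + 8/n` positions on average. (`levelOnePinning` + the energy floor `neg_centeredTripleSum_le_energy`; the
versions for `S` and `T` follow by `TripleProductProperty.rotate`.) [folklore] -/
theorem collisionFloor (n : ℕ) (hn : 40 ≤ n) (S T U : Finset (Equiv.Perm (Fin n)))
    (hTPP : TripleProductProperty S T U)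
    (hS : ∀ s ∈ S, ∀ s' ∈ S, Equiv.Perm.sign s = Equiv.Perm.sign s')
    (hT : ∀ t ∈ T, ∀ t' ∈ T, Equiv.Perm.sign t = Equiv.Perm.sign t')
    (hU : ∀ u ∈ U, ∀ u' ∈ U, Equiv.Perm.sign u = Equiv.Perm.sign u') :
    2 * ((S.card * T.card * U.card : ℕ) : ℝ) - (n.factorial : ℝ) -
        (n.factorial : ℝ) * Real.sqrt (n.factorial : ℝ) / Real.sqrt (((n * (n - 1) : ℕ) : ℝ) / 6) ≤
      ((n : ℝ) - 1) / 4 * ((S.card * T.card * U.card : ℕ) : ℝ) *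
        ∑ v : Fin n, ∑ q : Fin n, (((U.filter fun u => u q = v).card : ℝ) / U.card - 1 / n) ^ 2 := by
  classical
  set N : ℕ := S.card * T.card * U.card with hN
  set P : ℝ := ((S.card * T.card * U.card : ℕ) : ℝ) with hP
  have hn0 : n ≠ 0 := by omega
  have hD0 : 0 < Real.sqrt (((n * (n - 1) : ℕ) : ℝ) / 6) := by
    apply Real.sqrt_pos.2; apply div_pos _ (by norm_num)
    have : 0 < n * (n - 1) := Nat.mul_pos (by omega) (by omega)
    exact_mod_cast this
  have hE0 : 0 ≤ ∑ v : Fin n, ∑ q : Fin n,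
      (((U.filter fun u => u q = v).card : ℝ) / U.card - 1 / n) ^ 2 := by positivity
  have hm : (0 : ℝ) ≤ (n : ℝ) - 1 := by
    have : (40 : ℝ) ≤ n := by exact_mod_cast hn
    linarith
  -- degenerate case
  by_cases hN0 : N = 0
  · have hP0 : P = 0 := by rw [hP, ← hN, hN0, Nat.cast_zero]
    rw [hP0]
    have h1 : 0 ≤ (n.factorial : ℝ) * Real.sqrt (n.factorial : ℝ) / Real.sqrt (((n * (n - 1) : ℕ) : ℝ) / 6) := by
      positivity
    have h2 : (0 : ℝ) ≤ n.factorial := by positivity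
    simp only [mul_zero, zero_mul]
    linarith
  have hSne : S.Nonempty := Finset.card_ne_zero.1 fun h => hN0 (by simp [hN, h])
  have hTne : T.Nonempty := Finset.card_ne_zero.1 fun h => hN0 (by simp [hN, h])
  have hUne : U.Nonempty := Finset.card_ne_zero.1 fun h => hN0 (by simp [hN, h])
  have hNpos : (0 : ℝ) < P := by rw [hP, ← hN]; exact_mod_cast Nat.pos_of_ne_zero hN0
  have hS0r : (0 : ℝ) < S.card := by exact_mod_cast hSne.card_pos
  have hT0r : (0 : ℝ) < T.card := by exact_mod_cast hTne.card_pos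
  have hU0r : (0 : ℝ) < U.card := by exact_mod_cast hUne.card_pos
  -- (1) pinning and six-fold count
  have hpin := levelOnePinning n hn S T U hTPP hS hT hU
  set mA : Fin n → Fin n → ℝ := fun i j => (((S ×ˢ T).filter fun st => st.2 j = st.1 i).card : ℝ) with hmA
  set mB : Fin n → Fin n → ℝ := fun i j => (((T ×ˢ U).filter fun tu => tu.2 j = tu.1 i).card : ℝ) with hmB
  set mC : Fin n → Fin n → ℝ := fun i j => (((U ×ˢ S).filter fun us => us.2 j = us.1 i).card : ℝ) with hmC
  have hT3 : ((∑ y ∈ ((S ×ˢ T) ×ˢ (T ×ˢ U)) ×ˢ (U ×ˢ S),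
      (Finset.univ.filter fun p : Fin n =>
        (y.1.1.1⁻¹ * y.1.1.2 * (y.1.2.1⁻¹ * y.1.2.2) * (y.2.1⁻¹ * y.2.2)) p = p).card : ℕ) : ℝ) =
      ∑ i : Fin n, ∑ j : Fin n, ∑ k : Fin n, mA i j * mB j k * mC k i := by
    rw [sixFoldFix_eq_tripleSum S T U]
    push_cast
    refine Finset.sum_congr rfl fun i _ => ?_
    rw [Finset.sum_comm]
    refine Finset.sum_congr rfl fun j _ => Finset.sum_congr rfl fun k _ => ?_
    simp only [hmA, hmB, hmC]; ring
  -- (2) set profiles (doubly stochastic) and the factorisation of the pair marginals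
  set dS : Fin n → Fin n → ℝ := fun v i => ((S.filter fun s => s i = v).card : ℝ) / S.card with hdS
  set dT : Fin n → Fin n → ℝ := fun v i => ((T.filter fun t => t i = v).card : ℝ) / T.card with hdT
  set dU : Fin n → Fin n → ℝ := fun v i => ((U.filter fun u => u i = v).card : ℝ) / U.card with hdU
  have hdS0 : ∀ v i, 0 ≤ dS v i := fun v i => by positivity
  have hdT0 : ∀ v i, 0 ≤ dT v i := fun v i => by positivity
  have hrowS : ∀ v, ∑ i, dS v i = 1 := fun v => by
    simp only [hdS]; rw [← Finset.sum_div, sum_marginal_row S v, div_self hS0r.ne']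
  have hcolS : ∀ i, ∑ v, dS v i = 1 := fun i => by
    simp only [hdS]; rw [← Finset.sum_div, sum_marginal_col S i, div_self hS0r.ne']
  have hrowT : ∀ v, ∑ i, dT v i = 1 := fun v => by
    simp only [hdT]; rw [← Finset.sum_div, sum_marginal_row T v, div_self hT0r.ne']
  have hcolT : ∀ i, ∑ v, dT v i = 1 := fun i => by
    simp only [hdT]; rw [← Finset.sum_div, sum_marginal_col T i, div_self hT0r.ne']
  have hcolU : ∀ i, ∑ v, dU v i = 1 := fun i => by
    simp only [hdU]; rw [← Finset.sum_div, sum_marginal_col U i, div_self hU0r.ne']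
  have hrowU : ∀ v, ∑ i, dU v i = 1 := fun v => by
    simp only [hdU]; rw [← Finset.sum_div, sum_marginal_row U v, div_self hU0r.ne']
  have fA : ∀ i j, mA i j = S.card * T.card * ∑ v, dS v i * dT v j := fun i j => by
    simp only [hmA, hdS, hdT]
    rw [pairMarginal_eq_sum_mul S T i j, Finset.mul_sum]
    refine Finset.sum_congr rfl fun v _ => ?_
    field_simp
  have fB : ∀ j k, mB j k = T.card * U.card * ∑ v, dT v j * dU v k := fun j k => by
    simp only [hmB, hdT, hdU]
    rw [pairMarginal_eq_sum_mul T U j k, Finset.mul_sum]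
    refine Finset.sum_congr rfl fun v _ => ?_
    field_simp
  have fC : ∀ k i, mC k i = U.card * S.card * ∑ v, dU v k * dS v i := fun k i => by
    simp only [hmC, hdU, hdS]
    rw [pairMarginal_eq_sum_mul U S k i, Finset.mul_sum]
    refine Finset.sum_congr rfl fun v _ => ?_
    field_simp
  -- normalised pair arrays
  set a : Fin n → Fin n → ℝ := fun i j => ∑ v, dS v i * dT v j with ha
  set b : Fin n → Fin n → ℝ := fun j k => ∑ v, dT v j * dU v k with hb
  set c : Fin n → Fin n → ℝ := fun k i => ∑ v, dU v k * dS v i with hc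
  have hTsum : ∑ i : Fin n, ∑ j : Fin n, ∑ k : Fin n, mA i j * mB j k * mC k i =
      P ^ 2 * ∑ i : Fin n, ∑ j : Fin n, ∑ k : Fin n, a i j * b j k * c k i := by
    rw [Finset.mul_sum]
    refine Finset.sum_congr rfl fun i _ => ?_
    rw [Finset.mul_sum]
    refine Finset.sum_congr rfl fun j _ => ?_
    rw [Finset.mul_sum]
    refine Finset.sum_congr rfl fun k _ => ?_
    rw [fA, fB, fC, hP]; push_cast; ring
  -- row/column sums of a, b, c
  have har : ∀ i, ∑ j, a i j = 1 := fun i => by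
    simp only [ha]; rw [Finset.sum_comm]
    simp_rw [← Finset.mul_sum, hrowT, mul_one]; exact hcolS i
  have hbr : ∀ j, ∑ k, b j k = 1 := fun j => by
    simp only [hb]; rw [Finset.sum_comm]
    simp_rw [← Finset.mul_sum, hrowU, mul_one]; exact hcolT j
  have hbc : ∀ k, ∑ j, b j k = 1 := fun k => by
    simp only [hb]; rw [Finset.sum_comm]
    have e : ∀ v, ∑ j, dT v j * dU v k = dU v k * ∑ j, dT v j := fun v => by
      rw [Finset.mul_sum]; exact Finset.sum_congr rfl fun j _ => mul_comm _ _
    simp_rw [e, hrowT, mul_one]; exact hcolU k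
  have hcr : ∀ k, ∑ i, c k i = 1 := fun k => by
    simp only [hc]; rw [Finset.sum_comm]
    simp_rw [← Finset.mul_sum, hrowS, mul_one]; exact hcolU k
  have hcc : ∀ i, ∑ k, c k i = 1 := fun i => by
    simp only [hc]; rw [Finset.sum_comm]
    have e : ∀ v, ∑ k, dU v k * dS v i = dS v i * ∑ k, dU v k := fun v => by
      rw [Finset.mul_sum]; exact Finset.sum_congr rfl fun k _ => mul_comm _ _
    simp_rw [e, hrowU, mul_one]; exact hcolS i
  have hcen := centered_tripleSum_eq hn0 a b c har hbr hbc hcr hcc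
  -- (3) the energy floor
  have hfloor := neg_centeredTripleSum_le_energy hn0 dS dT dU hdS0 hrowS hcolS hdT0 hrowT hcolT hcolU
  change -(∑ i, ∑ j, ∑ k, (a i j - 1 / n) * (b j k - 1 / n) * (c k i - 1 / n)) ≤
    (∑ v, ∑ k, (dU v k - 1 / n) ^ 2) / 8 at hfloor
  -- (4) assemble
  rw [hT3, hTsum, Nat.cast_pow, ← hP] at hpin
  -- hpin : 2 P² − n! P − P n!√n!/√D ≤ 2(n−1)(P² − P²·Σabc) ; Σabc = 1 + Σ(a−1/n)… by hcen
  have hkey : 2 * ((n : ℝ) - 1) * (P ^ 2 - P ^ 2 * ∑ i, ∑ j, ∑ k, a i j * b j k * c k i) ≤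
      2 * ((n : ℝ) - 1) * (P ^ 2 * ((∑ v, ∑ k, (dU v k - 1 / n) ^ 2) / 8)) := by
    refine mul_le_mul_of_nonneg_left ?_ (by positivity)
    have e : P ^ 2 - P ^ 2 * ∑ i, ∑ j, ∑ k, a i j * b j k * c k i =
        P ^ 2 * (-(∑ i, ∑ j, ∑ k, (a i j - 1 / n) * (b j k - 1 / n) * (c k i - 1 / n))) := by
      rw [hcen]; ring
    rw [e]
    exact mul_le_mul_of_nonneg_left hfloor (by positivity)
  have hfin : 2 * P ^ 2 - (n.factorial : ℝ) * P -
      P * ((n.factorial : ℝ) * Real.sqrt (n.factorial : ℝ)) / Real.sqrt (((n * (n - 1) : ℕ) : ℝ) / 6) ≤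
      P * (((n : ℝ) - 1) / 4 * P * ∑ v, ∑ k, (dU v k - 1 / n) ^ 2) := by
    have h := hpin.trans hkey
    have e : 2 * ((n : ℝ) - 1) * (P ^ 2 * ((∑ v, ∑ k, (dU v k - 1 / n) ^ 2) / 8)) =
        P * (((n : ℝ) - 1) / 4 * P * ∑ v, ∑ k, (dU v k - 1 / n) ^ 2) := by ring
    linarith
  have hdiv : 2 * P - (n.factorial : ℝ) -
      (n.factorial : ℝ) * Real.sqrt (n.factorial : ℝ) / Real.sqrt (((n * (n - 1) : ℕ) : ℝ) / 6) ≤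
      ((n : ℝ) - 1) / 4 * P * ∑ v, ∑ k, (dU v k - 1 / n) ^ 2 := by
    have e : P * (2 * P - (n.factorial : ℝ) -
        (n.factorial : ℝ) * Real.sqrt (n.factorial : ℝ) / Real.sqrt (((n * (n - 1) : ℕ) : ℝ) / 6)) =
        2 * P ^ 2 - (n.factorial : ℝ) * P -
          P * ((n.factorial : ℝ) * Real.sqrt (n.factorial : ℝ)) / Real.sqrt (((n * (n - 1) : ℕ) : ℝ) / 6) := by
      ring
    refine le_of_mul_le_mul_left ?_ hNpos
    rw [e]; exact hfin
  simpa only [hdU] using hdiv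

end Summit.MatrixMultiplication.MatrixMultiplication.Theorems.PolynomialSlack
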